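import Literature.AnabelianGeometry.AbsoluteAnabelian.AbsTopII.CuspidalizationInputsGenSubpadic
import Literature.AnabelianGeometry.AbsoluteAnabelian.SubpadicExamples
import Literature.AnabelianGeometry.AbsoluteAnabelian.SubpadicIsGeneralizedSubpadic
import Literature.AnabelianGeometry.AbsoluteAnabelian.SlimTransport
import HarnessLib

/-!
# [AbsTopII] Cor 3.7 / Cor 3.8 as typed over `BelyiCurveModel` are SCHEMATA: their universal closures
# are refutable, and `Cor_3_7` is inhabited from centre-freeness alone (FACT-LIST F-0267 / F-0268)

S. Mochizuki, *Topics in Absolute Anabelian Geometry II: Decomposition Groups and Endomorphisms*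
[AbsTopII] (bib key `MochizukiAbsTopII2013`; manuscript pagination, lit key `paper:url-585b8d0ad0d9`):
Corollary 3.7 pp. 72–73, Corollary 3.8 p. 74, Remark 3.7.1 p. 73.

PROOF-ONLY negative-knowledge / scope companion (no definition, no instance, no structure) of
`AbsTopII/BelyiCuspidalization.lean` (abc-iut-L4-t6), cell abc-iut, seat abc-iut-f-064 (FACT-LIST rows
**F-0267** `BelyiCurveModel.Cor_3_7`, **F-0268** `BelyiCurveModel.Cor_3_8`; class `preparatory`,
kernel_closedness `parametrised`).

Both declarations are typed (cell ruling θ, shape (M)) as predicates on a MODEL INTERFACE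
`M : BelyiCurveModel` — free data: the curves, their extensions `Π ↠ G`, the NF-rational opens `U_X` and
their cuspidalizations `Π_{U_X} ↠ Π` — and the typing file says so itself ("no instance in the tree";
"a junk model falsifies only statements about itself"; `Cor_3_7`: "this statement carries the SHAPE of
the output and the centre-freeness behind (b), NOT the group-theoreticity of (a)").  What is NOT free is
the input predicate `IsCor37Input X` (base field generalized sub-`p`-adic, `G ≅ Gal(k̄/k)` slim, `χ_l`
with open image): by the tree's UNCONDITIONAL theorems
`BelyiCurveModel.isCor37Input_of_isGeneralizedSubpadicFor` ([Tpcs] Lem 4.14 and [AbsTopI] Ex 4.8 (i),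
kernel-proved), `AbsTopIII.IsSubpadicFor.padic` and `AbsTopIII.IsSubpadicFor.isGeneralizedSubpadicFor`
it HOLDS for every curve of strictly Belyi type of a model whose base field is `ℚ_2`.  Hence junk models
over the REAL field `ℚ_2` meet every hypothesis, and this file records:

* `BelyiCuspidalization.not_isoOver_of_central_mem_ker` — the content the output structure DOES carry:
  an output of the Cor-3.7 shape is never isomorphic over `Π` to a cuspidalization `Π_{U_X} ↠ Π` whose
  kernel contains a nontrivial CENTRAL element of `Π_{U_X}` (field `center_PiU_eq_bot`);
* `Cuspidalization.exists_belyiCuspidalization_of_center_eq_bot` — conversely ANY cuspidalization with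
  centre-free `Π_{U_X}` is the output of some `BelyiCuspidalization` (`Π_V := Π`, chain parameters
  `(0,0,0)`; the construction of the RQ7 probe A21g4-F1, `staging/L4/abc-iut-L6-t21/A21g4_Cor37VacuityProbe.lean`,
  here landed), whence the INSTANCE FORMS that hold: `BelyiCurveModel.cor_3_7_of_center_eq_bot`,
  `cor_3_7_of_isSlimGroup_cuspOf_arith`, `cor_3_7_of_isSlimGroup_cuspOf_geom` (Cor 3.7 as typed follows
  from the slimness of the `Δ_{U_X}` of the model — [AbsAnab] Lem 1.3.1 + `G` slim);
* `BelyiCurveModel.exists_not_cor_3_7_and_not_cor_3_8` / `not_forall_cor_3_7` / `not_forall_cor_3_8` —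
  **universal closures REFUTED** (universe `0`): the model with curves `{tt, ff}` over `ℚ_2`, all with
  extension `G_{ℚ_2} = G_{ℚ_2}` (`Δ = 1`), every curve of strictly Belyi type by fiat, ONE NF-open on `tt`
  with cuspidalization `G_{ℚ_2} × ℤ/2 ↠ G_{ℚ_2}` (kernel `ℤ/2` central) and NO NF-open on `ff`, violates
  `Cor_3_7` (centre) and `Cor_3_8` (no `U₂` to compare with, `φ = id`).

READING (honest framing): every statement here is about OUR typed interface — the two predicates are
HYPOTHESES ON A MODEL, to be consumed at the instance an étale-`π₁` model of hyperbolic orbicurves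
supplies (FOUNDATIONS row 12), never as universally quantified binders (a certificate binding
`∀ M, M.Cor_3_8` would be vacuous).  NOTHING in print is contradicted: Cor 3.7 / 3.8 are theorems about
the étale fundamental groups of hyperbolic orbicurves of strictly Belyi type, objects the tree does not
construct.  Refuted-as-schema ≠ refuted-in-print; no side taken on [IUTchIII] Cor 3.12; typed ≠ proved.
-/

open CategoryTheory Topology
open scoped Pointwise

universe u

namespace Literature.AnabelianGeometry.AbsoluteAnabelian.AbsTopII

open Literature.AlgebraicGeometry.Frobenioids (IsSlimGroup)
open FundamentalExtension
open AbsTopIII (IsGeneralizedSubpadicFor IsSubpadicFor cyclotomicChar)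

variable {E : FundamentalExtension.{u}}

/-! ## What the output structure of Cor 3.7 carries: centre-freeness of `Π_U` -/

/-- An output of the Cor-3.7 shape is never isomorphic over `Π` to a cuspidalization `Π_{U_X} ↠ Π`
whose kernel contains a nontrivial central element `a` of `Π_{U_X}`: transported along the isomorphism,
`a` would be a nontrivial central element of `Π_U = Π_V ×_Π Π_{U_X}`, against `center_PiU_eq_bot`
(Cor 3.7 (b): "`Π_{U_X}` may be recovered [...] by forming `⋊^out`", which needs `Π_U` centre-free).
[cite: MochizukiAbsTopII2013, Cor 3.7 (b) p.73] -/
theorem BelyiCuspidalization.not_isoOver_of_central_mem_ker (B : BelyiCuspidalization E)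
    (c : Cuspidalization E) (a : c.ext.arith) (ha : a ≠ 1) (hker : c.hom.arith a = 1)
    (hcomm : ∀ z, a * z = z * a) : ¬ B.cusp.IsoOver c := by
  rintro ⟨β, hβ⟩
  have hβy : β (β.symm a) = a := β.apply_symm_apply a
  have hyU : β.symm a ∈ B.PiV.comap B.cusp.hom.arith.toMonoidHom := by
    rw [Subgroup.mem_comap]
    change B.cusp.hom.arith (β.symm a) ∈ B.PiV
    rw [← hβ (β.symm a), hβy, hker]
    exact one_mem _
  have hcen : (⟨β.symm a, hyU⟩ : ↥(B.PiV.comap B.cusp.hom.arith.toMonoidHom)) ∈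
      Subgroup.center ↥(B.PiV.comap B.cusp.hom.arith.toMonoidHom) := by
    rw [Subgroup.mem_center_iff]
    rintro ⟨z, hz⟩
    apply Subtype.ext
    change z * β.symm a = β.symm a * z
    apply EquivLike.injective β
    rw [map_mul, map_mul, hβy]
    exact (hcomm (β z)).symm
  rw [B.center_PiU_eq_bot, Subgroup.mem_bot] at hcen
  have h1 : β.symm a = 1 := congrArg Subtype.val hcen
  exact ha (by rw [← hβy, h1, map_one])

/-- Conversely, ANY cuspidalization `c : Π_{U_X} ↠ Π` whose `Π_{U_X}` is centre-free, with any cuspidal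
data on it, is the output of a `BelyiCuspidalization` of `Π ↠ G`: take `Π_V := Π` (so `Π_U = Π_{U_X}`,
the unique-lifting clause (b) is about the trivial group `Π/Π_V`), chain parameters `(l,n,m) = (0,0,0)`
(type-chain `⋏, ⋎, ⋏, ⋎`).  This is the RQ7 finding A21g4-F1 on the typed statement: it records the
SHAPE of the output and the centre-freeness behind (b), not the group-theoreticity of (a).
[cite: MochizukiAbsTopII2013, Cor 3.7 pp.72-73] -/
theorem Cuspidalization.exists_belyiCuspidalization_of_center_eq_bot (c : Cuspidalization E)
    (C : CuspidalData c.ext) (hZ : Subgroup.center c.ext.arith = ⊥) :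
    ∃ B : BelyiCuspidalization E, B.cusp.IsoOver c ∧
      B.cusp.decompositionImages B.cusps = c.decompositionImages C ∧
      B.PiV = ⊤ ∧ B.typeChain = Ex_3_6_ii_typeChain 0 0 0 := by
  have hcen : Subgroup.center ↥((⊤ : Subgroup E.arith).comap c.hom.arith.toMonoidHom) = ⊥ := by
    rw [eq_bot_iff]
    intro z hz
    rw [Subgroup.mem_bot]
    have hz' : (z : c.ext.arith) ∈ Subgroup.center c.ext.arith := by
      rw [Subgroup.mem_center_iff]
      intro g
      have hg : g ∈ (⊤ : Subgroup E.arith).comap c.hom.arith.toMonoidHom := by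
        rw [Subgroup.mem_comap]
        exact Subgroup.mem_top _
      exact congrArg Subtype.val (Subgroup.mem_center_iff.1 hz ⟨g, hg⟩)
    rw [hZ, Subgroup.mem_bot] at hz'
    exact Subtype.ext hz'
  refine ⟨{ PiV := ⊤
            normal_PiV := inferInstance
            isOpen_PiV := by
              rw [Subgroup.coe_top]
              exact isOpen_univ
            chainParams := (0, 0, 0)
            cuspU := c.ext
            projU := c.hom
            range_projU_arith := MonoidHom.range_eq_top.2 c.arith_surjective
            range_projU_gal := by
              rw [MonoidHom.range_eq_top.2 c.gal_bijective.2, ← MonoidHom.range_eq_map,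
                MonoidHom.range_eq_top.2 E.aug_surjective]
            cusp := c
            glue := (MulEquiv.subgroupCongr (Subgroup.comap_top _)).trans Subgroup.topEquiv
            glue_comm := fun _ => rfl
            lifting_unique := fun ρ ρ' hρ hρ' _ _ => by
              refine MonoidHom.ext fun g => ?_
              rw [(MonoidHom.mem_ker).1 (hρ (Subgroup.mem_top g)),
                (MonoidHom.mem_ker).1 (hρ' (Subgroup.mem_top g))]
            center_PiU_eq_bot := hcen
            cusps := C }, Cuspidalization.IsoOver.refl _, rfl, rfl, rfl⟩

/-- The Galois group `G'` of a cuspidalization `Π_{U_X} ↠ G'` of `Π ↠ G` is bi-continuously isomorphic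
to `G` (the `G`-component is a continuous bijection of profinite groups), so it is slim when `G` is.
[cite: MochizukiAbsTopII2013, Cor 3.7 p.73] -/
theorem Cuspidalization.isSlimGroup_gal (c : Cuspidalization E) (hG : IsSlimGroup E.gal) :
    IsSlimGroup c.ext.gal := by
  let h : c.ext.gal ≃ₜ E.gal :=
    Continuous.homeoOfEquivCompactToT2 (f := Equiv.ofBijective c.hom.gal c.gal_bijective)
      c.hom.gal.continuous
  let e : c.ext.gal ≃ₜ* E.gal :=
    { MulEquiv.ofBijective c.hom.gal c.gal_bijective with
      continuous_toFun := c.hom.gal.continuous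
      continuous_invFun := h.symm.continuous }
  exact isSlimGroup_of_continuousMulEquiv e.symm hG

namespace BelyiCurveModel

variable (M : BelyiCurveModel.{u})

/-! ## F-0267: instance forms of `BelyiCurveModel.Cor_3_7` that DO hold -/

/-- **`Cor_3_7 M` from centre-freeness alone**: if every `Π_{U_X}` of the model (for `X` satisfying the
Cor-3.7 hypotheses) has trivial centre, then `Cor_3_7 M` holds — the model's own `π₁(U_X) ↠ π₁(X)`
with `V := X` is the witness (RQ7 A21g4-F1). [cite: MochizukiAbsTopII2013, Cor 3.7 pp.72-73] -/
theorem cor_3_7_of_center_eq_bot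
    (hZ : ∀ X : M.Curve, M.IsCor37Input X → ∀ U : M.Open X,
      Subgroup.center (M.cuspOf U).ext.arith = ⊥) :
    M.Cor_3_7 := by
  intro X hX U
  obtain ⟨B, h₁, h₂, -, -⟩ :=
    (M.cuspOf U).exists_belyiCuspidalization_of_center_eq_bot (M.cuspsOf U) (hZ X hX U)
  exact ⟨B, h₁, h₂⟩

/-- `Cor_3_7 M` from the slimness of the `Π_{U_X}` of the model (a slim group is centre-free: its centre
centralises the open subgroup `Π_{U_X}` itself). [cite: MochizukiAbsTopII2013, Cor 3.7 pp.72-73] -/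
theorem cor_3_7_of_isSlimGroup_cuspOf_arith
    (hP : ∀ X : M.Curve, M.IsCor37Input X → ∀ U : M.Open X, IsSlimGroup (M.cuspOf U).ext.arith) :
    M.Cor_3_7 := by
  refine M.cor_3_7_of_center_eq_bot fun X hX U => ?_
  rw [eq_bot_iff]
  intro g hg
  rw [← (hP X hX U).centralizer_eq_bot ⊤ isOpen_univ, Subgroup.mem_centralizer_iff]
  exact fun x _ => (Subgroup.mem_center_iff.mp hg) x

/-- **Cor 3.7 as typed, CONDITIONAL on a classical input only**: if the geometric fundamental groups
`Δ_{U_X}` of the model's NF-opens are slim, then `Cor_3_7 M` holds — `Π_{U_X}` is then slim ([AbsAnab]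
Lem 1.3.1, the tree's `arith_slim_of_geom_slim_of_gal_slim`, with "`G` slim" from `IsCor37Input` carried
to the cuspidalization's Galois group by `Cuspidalization.isSlimGroup_gal`), hence centre-free.
[cite: MochizukiAbsTopII2013, Cor 3.7 pp.72-73] -/
theorem cor_3_7_of_isSlimGroup_cuspOf_geom
    (hΔ : ∀ X : M.Curve, M.IsCor37Input X → ∀ U : M.Open X, IsSlimGroup (M.cuspOf U).ext.geom) :
    M.Cor_3_7 :=
  M.cor_3_7_of_isSlimGroup_cuspOf_arith fun X hX U =>
    (M.cuspOf U).ext.arith_slim_of_geom_slim_of_gal_slim (hΔ X hX U)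
      ((M.cuspOf U).isSlimGroup_gal hX.slim)

/-- Instance form that holds VACUOUSLY: a model none of whose curves has an NF-rational open satisfies
`Cor_3_7`. [cite: MochizukiAbsTopII2013, Cor 3.7 pp.72-73] -/
theorem cor_3_7_of_isEmpty_open (h : ∀ X : M.Curve, IsEmpty (M.Open X)) : M.Cor_3_7 :=
  fun X _ U => (h X).elim U

/-! ## F-0268: instance form of `BelyiCurveModel.Cor_3_8` that holds -/

/-- Instance form that holds VACUOUSLY: a model none of whose curves has an NF-rational open satisfies
`Cor_3_8` (its conclusion quantifies over the opens `U_{X₁}`). [cite: MochizukiAbsTopII2013, Cor 3.8 p.74] -/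
theorem cor_3_8_of_isEmpty_open (h : ∀ X : M.Curve, IsEmpty (M.Open X)) : M.Cor_3_8 :=
  fun X₁ _ _ _ _ _ _ U₁ => (h X₁).elim U₁

/-! ## F-0267 / F-0268: the universal closures are REFUTED -/

/-- **The junk model over `ℚ_2`** (universe `0`).  Curves `tt`, `ff`, both with extension
`G_{ℚ_2} ↠ G_{ℚ_2}` (identity, `Δ = 1`), base field `ℚ_2` with `G ≅ Gal(ℚ̄_2/ℚ_2)` the identity, all
finite étale morphisms identities, every curve a genus-`0` scheme "defined over a number field" (so of
strictly Belyi type by fiat); `tt` has ONE NF-open whose cuspidalization is `G_{ℚ_2} × ℤ/2 ↠ G_{ℚ_2}`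
(first projection; no cusps), `ff` has NONE.  Every curve satisfies `IsCor37Input` UNCONDITIONALLY
(`ℚ_2` is sub-`2`-adic hence generalized sub-`2`-adic; [Tpcs] Lem 4.14 and [AbsTopI] Ex 4.8 (i) are
kernel theorems of the tree), yet `Cor_3_7` fails (the kernel `ℤ/2` is central in `Π_{U}`:
`not_isoOver_of_central_mem_ker`) and `Cor_3_8` fails (for `φ = id : Π_{tt} ⥲ Π_{ff}` there is no
`U_{ff}`).  [cite: MochizukiAbsTopII2013, Cor 3.7 pp.72-73] -/
theorem exists_not_cor_3_7_and_not_cor_3_8 :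
    ∃ M : BelyiCurveModel.{0}, ¬ M.Cor_3_7 ∧ ¬ M.Cor_3_8 := by
  let Γ : ProfiniteGrp.{0} := absoluteGaloisGrp ℚ_[2]
  let A : ProfiniteGrp.{0} := ProfiniteGrp.ofFiniteGrp (FiniteGrp.of (Multiplicative (ZMod 2)))
  let E₀ : FundamentalExtension.{0} :=
    { arith := Γ, gal := Γ, aug := ContinuousMonoidHom.id Γ, aug_surjective := Function.surjective_id }
  -- the junk cuspidalization `Π_U := G_{ℚ_2} × ℤ/2 ↠ G_{ℚ_2}`
  let E₁ : FundamentalExtension.{0} :=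
    { arith := ProfiniteGrp.of (Γ × A), gal := Γ, aug := ContinuousMonoidHom.fst Γ A
      aug_surjective := fun g => ⟨(g, 1), rfl⟩ }
  let f : E₁ ⟶ E₀ := ⟨ContinuousMonoidHom.fst Γ A, ContinuousMonoidHom.id Γ, fun _ => rfl⟩
  let c : Cuspidalization E₀ := ⟨E₁, f, fun g => ⟨(g, 1), rfl⟩, Function.bijective_id⟩
  let C : CuspidalData E₁ :=
    { Cusp := PEmpty.{1}
      Dcusp := fun x => x.elim
      Icusp := fun x => x.elim
      Icusp_eq := fun x => x.elim
      isClosed_Dcusp := fun x => x.elim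
      eq_of_conj := fun x => x.elim }
  let M : BelyiCurveModel.{0} :=
    { Curve := Bool
      ext := fun _ => E₀
      FinEt := fun _ _ => PUnit.{1}
      extMap := fun _ => 𝟙 E₀
      extMap_isOpenInjective := fun _ => Hom.IsOpenInjective.id E₀
      IsScheme := fun _ => True
      genus := fun _ => 0
      cuspCard := fun _ => 0
      IsDefinedOverNF := fun _ => True
      base := fun _ => ℚ_[2]
      instField := fun _ => inferInstance
      instCharZero := fun _ => inferInstance
      galIso := fun _ => Iso.refl _
      Open := fun b => cond b PUnit.{1} PEmpty.{1}
      cuspOf := fun _ => c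
      cuspsOf := fun _ => C }
  have hk : IsGeneralizedSubpadicFor ℚ_[2] 2 := (IsSubpadicFor.padic 2).isGeneralizedSubpadicFor
  have hB : ∀ X : M.Curve, M.IsStrictlyBelyiType X := fun X =>
    ⟨trivial, X, trivial, rfl, X, ⟨PUnit.unit⟩, ⟨PUnit.unit⟩⟩
  have hX : ∀ X : M.Curve, M.IsCor37Input X := fun X =>
    M.isCor37Input_of_isGeneralizedSubpadicFor (hB X) hk
  -- the nontrivial central element `(1, -1)` of `Π_U`, in the kernel of `Π_U ↠ Π`
  let a : Multiplicative (ZMod 2) := Multiplicative.ofAdd 1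
  have ha : a ≠ 1 := Multiplicative.ofAdd.injective.ne (by decide : (1 : ZMod 2) ≠ 0)
  have hcomm : ∀ z : Γ × A, ((1, a) : Γ × A) * z = z * (1, a) := by
    rintro ⟨u, b⟩
    refine Prod.ext ?_ (@mul_comm (Multiplicative (ZMod 2)) _ a b)
    change 1 * u = u * 1
    rw [one_mul, mul_one]
  refine ⟨M, fun h37 => ?_, fun h38 => ?_⟩
  · obtain ⟨B, hiso, -⟩ := h37 true (hX true) PUnit.unit
    exact B.not_isoOver_of_central_mem_ker c ((1, a) : Γ × A)
      (fun h => ha (Prod.mk_eq_one.mp h).2) rfl hcomm hiso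
  · have hcyc : IsOpen (Set.range (cyclotomicChar ℚ_[2] 2)) := hk.isOpen_range_cyclotomicChar
    obtain ⟨U₂, -⟩ := h38 true false (hX true) (hX false) ⟨2, inferInstance, hcyc, hcyc⟩
      (ContinuousMulEquiv.refl _) (by
        ext x
        simp only [Subgroup.mem_map]
        constructor
        · rintro ⟨y, hy, rfl⟩
          exact hy
        · exact fun hx => ⟨x, hx, rfl⟩) PUnit.unit
    exact PEmpty.elim U₂

/-- **FACT-LIST F-0267, universal closure REFUTED** (universe `0`): it is not the case that `Cor_3_7 M`
holds for every `BelyiCurveModel` `M` — the statement is a HYPOTHESIS ON THE MODEL (bindable per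
instance), not a closed fact.  Cor 3.7 itself (Belyi cuspidalization of hyperbolic orbicurves of
strictly Belyi type) is not touched. [cite: MochizukiAbsTopII2013, Cor 3.7 pp.72-73] -/
theorem not_forall_cor_3_7 : ¬ ∀ M : BelyiCurveModel.{0}, M.Cor_3_7 := by
  intro H
  obtain ⟨M, h37, -⟩ := exists_not_cor_3_7_and_not_cor_3_8
  exact h37 (H M)

/-- **FACT-LIST F-0268, universal closure REFUTED** (universe `0`): it is not the case that `Cor_3_8 M`
holds for every `BelyiCurveModel` `M` — a HYPOTHESIS ON THE MODEL, not a closed fact.  Cor 3.8 itself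
(the comparison of NF-opens along `φ : Π₁ ⥲ Π₂`) is not touched. [cite: MochizukiAbsTopII2013, Cor 3.8 p.74] -/
theorem not_forall_cor_3_8 : ¬ ∀ M : BelyiCurveModel.{0}, M.Cor_3_8 := by
  intro H
  obtain ⟨M, -, h38⟩ := exists_not_cor_3_7_and_not_cor_3_8
  exact h38 (H M)

end BelyiCurveModel

end Literature.AnabelianGeometry.AbsoluteAnabelian.AbsTopII
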